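import Summits.NavierStokesRegularity.NavierStokesRegularity.Theses.AngularGalerkinLadder
import Literature.Analysis.FluidPDE.SelfSimilarLiouvilleConsequences

/-!
# KJ-17 — the refutation price of `AngularGalerkinLadder.LimitTransfer` (item 19961) is
«an admissible window sequence exists ∧ the Type-I rotated-DSS Liouville conjecture»

Refuter bookkeeping (ns-blowup refuter lineage, plain Negative lane, `--supports` item
stmt-NavierStokesRegularity-19961; no definition, no positive route statement). The crux
`LimitTransfer` (card K3 of route `AngularGalerkinLadder`) quantifies over sequences of window rung
profiles of the angular Galerkin ladder and concludes with the EXISTENCE of a nontrivial Type-I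
rotated-discretely-self-similar ancient mild solution `v` of true Navier–Stokes — but `v`, its factor
`c'` and its rotation `R'` are NOT tied to the sequence (no extraction, no convergence clause; the
planner of record keeps this deliberately as the weakest load-bearing form, the convergence topology
being a line's choice). This file records, kernel-checked, what that typing means for refuters:

* `exists_rdssProfile_iff_not_typeIDSSLiouvilleConjecture` — the conclusion-object of K3 is verbatim
  the negation of the canonical wall `TypeIDSSLiouvilleConjecture` (Bradshaw–Tsai 2017, §5, Open
  Problem 5.1; Tsai GSM 192 Conj. 8.8–8.9), i.e. crux #5 `Blowup.BlowupTypeIDssProfile` of route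
  `Blowup` (definitionally);
* `not_limitTransfer_iff` — THE PRICE: `¬ LimitTransfer ↔ (∃ admissible window sequence) ∧
  TypeIDSSLiouvilleConjecture`; the two halves are `exists_windowSequence_of_not_limitTransfer` and
  `typeIDSSLiouvilleConjecture_of_not_limitTransfer` («a refutation of K3 is a proof of Open Problem
  5.1»), the converse is `not_limitTransfer_of`;
* `not_limitTransfer_iff_conjecture_of_windows` — PARAMETER BLINDNESS: once ANY admissible window
  sequence exists, `¬ LimitTransfer ↔ TypeIDSSLiouvilleConjecture`, whatever the sequence's Type-I
  constant `C₀`, factor window `[cmin, cmax]`, amplitude `δ` or symmetry. Consequently the two «cheap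
  refuter checks» the route text invites against K3 — a factor window inside Chae–Wolf's fine range
  `1 < λ < λ_*(C_*)` (arXiv:1610.09464 Thm 1.3) and an axisymmetric collapse of the sequence
  (Seregin–Šverák 2009) — are VOID against the item AS TYPED: they constrain which `v` a faithful LIMIT
  statement could output (the planner's pre-typed contingency `LadderLimitTransfer`, locally uniform
  slice convergence of a subsequence), not the typed conclusion, whose witnesses are free;
* `not_blowupTypeIDssProfile_of_not_limitTransfer` — cross-route edge: a refutation of K3 refutes
  crux #5 of route `Blowup` (stmt-NavierStokesRegularity-0155) and with it every line premised on it;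
* `not_typeIDSSLiouvilleConjecture_of_ladder` — the whole ladder `K1 ∧ K2 ∧ K3` disproves the wall on
  its way to Clay (C): the route is a MECHANISM for Blowup's crux #5, and cannot close in any world
  where the Type-I DSS Liouville conjecture holds; the printed partial Liouville theorems (λ-continuous
  profiles: Nečas–Růžička–Šverák 1996 / Tsai 1998; fine range: Chae–Wolf 2017 Thm 1.3; axisymmetric
  Type I: Seregin–Šverák 2009) restrict the OUTPUT class only.

WHAT THIS IS NOT: not NS — pure logic over the route file and the accepted equivalence
`typeIDSSLiouvilleConjecture_iff`; no profile, window or rung solution is constructed or excluded.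
References: [cite: BradshawTsai2017CPDE, §5 Open Problem 5.1]; [cite: KochNadirashviliSereginSverak2009, §1 and §5].
-/

namespace Summit.NavierStokesRegularity.AngularGalerkinLadderWallPrice

open Filter Topology MeasureTheory
open Literature.Analysis.FluidPDE hiding TypeIDSSLiouvilleConjecture
open Summit.NavierStokesRegularity.FluidComputer
open Summit.NavierStokesRegularity.NavierStokesRegularity
open Summit.NavierStokesRegularity.NavierStokesRegularity.Theses.AngularGalerkinLadder

/-- The conclusion-object of `LimitTransfer` — a nontrivial Type-I rotated-`λ`-DSS ancient mild
solution of Navier–Stokes (`ν = 1`) with measurable slices — exists iff the canonical Type-I DSS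
Liouville wall fails (Bradshaw–Tsai 2017, §5, Open Problem 5.1, in its rotated form via the accepted
`typeIDSSLiouvilleConjecture_iff`). [cite: BradshawTsai2017CPDE, §5 Open Problem 5.1] -/
theorem exists_rdssProfile_iff_not_typeIDSSLiouvilleConjecture :
    (∃ (c' : ℝ) (R' : EuclideanSpace ℝ (Fin 3) ≃ₗᵢ[ℝ] EuclideanSpace ℝ (Fin 3))
        (v : ℝ → EuclideanSpace ℝ (Fin 3) → EuclideanSpace ℝ (Fin 3)),
        1 < c' ∧ IsAncientMildSolution 1 v ∧
        (∀ t < 0, AEStronglyMeasurable (v t) volume) ∧ IsRotatedDSS c' R' v ∧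
        (∃ C : ℝ, HasTypeIDecay C v) ∧ ¬ (∀ t < 0, v t =ᵐ[volume] 0)) ↔
      ¬ TypeIDSSLiouvilleConjecture := by
  rw [typeIDSSLiouvilleConjecture_iff]
  constructor
  · rintro ⟨c', R', v, hc, hmild, hmeas, hdss, hdec, hnz⟩ hW
    exact hnz (hW c' R' hc v hmild hmeas hdss hdec)
  · intro hW
    by_contra hne
    apply hW
    intro c R hc u hmild hmeas hdss hdec
    by_contra hnz
    exact hne ⟨c, R, u, hc, hmild, hmeas, hdss, hdec, hnz⟩

/-- The same conclusion-object is DEFINITIONALLY crux #5 `BlowupTypeIDssProfile` of route `Blowup`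
(stmt-NavierStokesRegularity-0155: the wall negated, constant unfolded one level). [folklore] -/
theorem blowupTypeIDssProfile_iff_not_typeIDSSLiouvilleConjecture :
    Theses.Blowup.BlowupTypeIDssProfile ↔ ¬ TypeIDSSLiouvilleConjecture :=
  Iff.rfl

/-- First half of the price: if `LimitTransfer` fails, SOME admissible window sequence exists
(constants `1 < cmin`, `0 < δ`, defect sizes `ε_n → 0`, a window rung profile at every index);
in particular `¬ LimitTransfer` is unprovable while no window rung profile has been constructed.
[folklore] -/
theorem exists_windowSequence_of_not_limitTransfer (h : ¬ LimitTransfer) :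
    ∃ (C₀ cmin cmax δ : ℝ) (L : ℕ → ℕ) (ε c : ℕ → ℝ)
      (R : ℕ → (EuclideanSpace ℝ (Fin 3) ≃ₗᵢ[ℝ] EuclideanSpace ℝ (Fin 3)))
      (u : ℕ → ℝ → EuclideanSpace ℝ (Fin 3) → EuclideanSpace ℝ (Fin 3))
      (p : ℕ → ℝ → EuclideanSpace ℝ (Fin 3) → ℝ)
      (d : ℕ → ℝ → EuclideanSpace ℝ (Fin 3) → EuclideanSpace ℝ (Fin 3)),
      1 < cmin ∧ 0 < δ ∧ Tendsto ε atTop (𝓝 0) ∧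
        ∀ n, AngularLadder.IsWindowProfile (L n) C₀ cmin cmax δ (ε n) (c n) (R n) (u n) (p n)
          (d n) := by
  by_contra hno
  apply h
  intro C₀ cmin cmax δ L ε c R u p d hcmin hδ hε hwin
  exact absurd ⟨C₀, cmin, cmax, δ, L, ε, c, R, u, p, d, hcmin, hδ, hε, hwin⟩ hno

/-- Second half of the price: a refutation of `LimitTransfer` is a PROOF of the Type-I rotated-DSS
Liouville conjecture (Bradshaw–Tsai 2017, §5, Open Problem 5.1) — the conclusion of K3 does not
mention the sequence, so its failure for one sequence is the non-existence of every profile.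
[cite: BradshawTsai2017CPDE, §5 Open Problem 5.1] -/
theorem typeIDSSLiouvilleConjecture_of_not_limitTransfer (h : ¬ LimitTransfer) :
    TypeIDSSLiouvilleConjecture := by
  by_contra hW
  apply h
  intro C₀ cmin cmax δ L ε c R u p d _ _ _ _
  exact exists_rdssProfile_iff_not_typeIDSSLiouvilleConjecture.2 hW

/-- Converse: the wall together with ONE admissible window sequence refutes `LimitTransfer`.
[folklore] -/
theorem not_limitTransfer_of (hW : TypeIDSSLiouvilleConjecture)
    (hwin : ∃ (C₀ cmin cmax δ : ℝ) (L : ℕ → ℕ) (ε c : ℕ → ℝ)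
      (R : ℕ → (EuclideanSpace ℝ (Fin 3) ≃ₗᵢ[ℝ] EuclideanSpace ℝ (Fin 3)))
      (u : ℕ → ℝ → EuclideanSpace ℝ (Fin 3) → EuclideanSpace ℝ (Fin 3))
      (p : ℕ → ℝ → EuclideanSpace ℝ (Fin 3) → ℝ)
      (d : ℕ → ℝ → EuclideanSpace ℝ (Fin 3) → EuclideanSpace ℝ (Fin 3)),
      1 < cmin ∧ 0 < δ ∧ Tendsto ε atTop (𝓝 0) ∧
        ∀ n, AngularLadder.IsWindowProfile (L n) C₀ cmin cmax δ (ε n) (c n) (R n) (u n) (p n)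
          (d n)) :
    ¬ LimitTransfer := by
  rintro hK3
  obtain ⟨C₀, cmin, cmax, δ, L, ε, c, R, u, p, d, hcmin, hδ, hε, hwin⟩ := hwin
  exact exists_rdssProfile_iff_not_typeIDSSLiouvilleConjecture.1
    (hK3 C₀ cmin cmax δ L ε c R u p d hcmin hδ hε hwin) hW

/-- **THE PRICE of refuting K3.** `LimitTransfer` fails iff an admissible window sequence exists AND
the Type-I rotated-DSS Liouville conjecture holds. Neither conjunct is refuter-accessible today: the
first needs a constructed window rung profile of the angular Galerkin ladder, the second is
Bradshaw–Tsai's Open Problem 5.1. [cite: BradshawTsai2017CPDE, §5 Open Problem 5.1] -/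
theorem not_limitTransfer_iff :
    ¬ LimitTransfer ↔
      (∃ (C₀ cmin cmax δ : ℝ) (L : ℕ → ℕ) (ε c : ℕ → ℝ)
          (R : ℕ → (EuclideanSpace ℝ (Fin 3) ≃ₗᵢ[ℝ] EuclideanSpace ℝ (Fin 3)))
          (u : ℕ → ℝ → EuclideanSpace ℝ (Fin 3) → EuclideanSpace ℝ (Fin 3))
          (p : ℕ → ℝ → EuclideanSpace ℝ (Fin 3) → ℝ)
          (d : ℕ → ℝ → EuclideanSpace ℝ (Fin 3) → EuclideanSpace ℝ (Fin 3)),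
          1 < cmin ∧ 0 < δ ∧ Tendsto ε atTop (𝓝 0) ∧
            ∀ n, AngularLadder.IsWindowProfile (L n) C₀ cmin cmax δ (ε n) (c n) (R n) (u n) (p n)
              (d n)) ∧
        TypeIDSSLiouvilleConjecture :=
  ⟨fun h => ⟨exists_windowSequence_of_not_limitTransfer h,
      typeIDSSLiouvilleConjecture_of_not_limitTransfer h⟩,
    fun h => not_limitTransfer_of h.2 h.1⟩

/-- **PARAMETER BLINDNESS.** Once ANY admissible window sequence exists — whatever its Type-I constant,
factor window, amplitude or symmetry (fine-range factors `1 < c_n < λ_*(C₀)` and axisymmetric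
sequences included) — refuting `LimitTransfer` is EXACTLY proving the Type-I rotated-DSS Liouville
conjecture. Hence the fine-range check (Chae–Wolf, arXiv:1610.09464, Thm 1.3) and the axisymmetric
check (Seregin–Šverák 2009) invited by the route text do not bear on the item as typed; they bear on
limit statements that tie `v` to the sequence. [cite: BradshawTsai2017CPDE, §5 Open Problem 5.1] -/
theorem not_limitTransfer_iff_conjecture_of_windows
    (hwin : ∃ (C₀ cmin cmax δ : ℝ) (L : ℕ → ℕ) (ε c : ℕ → ℝ)
      (R : ℕ → (EuclideanSpace ℝ (Fin 3) ≃ₗᵢ[ℝ] EuclideanSpace ℝ (Fin 3)))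
      (u : ℕ → ℝ → EuclideanSpace ℝ (Fin 3) → EuclideanSpace ℝ (Fin 3))
      (p : ℕ → ℝ → EuclideanSpace ℝ (Fin 3) → ℝ)
      (d : ℕ → ℝ → EuclideanSpace ℝ (Fin 3) → EuclideanSpace ℝ (Fin 3)),
      1 < cmin ∧ 0 < δ ∧ Tendsto ε atTop (𝓝 0) ∧
        ∀ n, AngularLadder.IsWindowProfile (L n) C₀ cmin cmax δ (ε n) (c n) (R n) (u n) (p n)
          (d n)) :
    ¬ LimitTransfer ↔ TypeIDSSLiouvilleConjecture :=
  ⟨typeIDSSLiouvilleConjecture_of_not_limitTransfer, fun hW => not_limitTransfer_of hW hwin⟩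

/-- Without a window sequence the item is (vacuously) TRUE: if no admissible window sequence exists,
`LimitTransfer` holds — stated negatively, `¬ LimitTransfer` certifies a window sequence. This is the
K3-analogue of «K2 ⟸ ¬K1» (refuter4 K85 (iii)). [folklore] -/
theorem not_not_limitTransfer_of_no_windows
    (hno : ¬ ∃ (C₀ cmin cmax δ : ℝ) (L : ℕ → ℕ) (ε c : ℕ → ℝ)
      (R : ℕ → (EuclideanSpace ℝ (Fin 3) ≃ₗᵢ[ℝ] EuclideanSpace ℝ (Fin 3)))
      (u : ℕ → ℝ → EuclideanSpace ℝ (Fin 3) → EuclideanSpace ℝ (Fin 3))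
      (p : ℕ → ℝ → EuclideanSpace ℝ (Fin 3) → ℝ)
      (d : ℕ → ℝ → EuclideanSpace ℝ (Fin 3) → EuclideanSpace ℝ (Fin 3)),
      1 < cmin ∧ 0 < δ ∧ Tendsto ε atTop (𝓝 0) ∧
        ∀ n, AngularLadder.IsWindowProfile (L n) C₀ cmin cmax δ (ε n) (c n) (R n) (u n) (p n)
          (d n)) :
    ¬ ¬ LimitTransfer :=
  fun h => hno (exists_windowSequence_of_not_limitTransfer h)

/-- **Cross-route edge.** A refutation of `LimitTransfer` refutes crux #5 `BlowupTypeIDssProfile` of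
route `Blowup` (stmt-NavierStokesRegularity-0155) — and therefore breaks every line premised on it.
[folklore] -/
theorem not_blowupTypeIDssProfile_of_not_limitTransfer (h : ¬ LimitTransfer) :
    ¬ Theses.Blowup.BlowupTypeIDssProfile :=
  fun h5 => h5 (typeIDSSLiouvilleConjecture_of_not_limitTransfer h)

/-- The window sequence the deciding theorem `closes` builds from K1 ∧ K2: cofinal singular rungs
(`RungBlowupCofinal`) and the uniform window (`NoOverheating`) give an admissible window sequence with
defect sizes `ε (L n) → 0` (rungs `L n ≥ n`). [folklore] -/
theorem exists_windowSequence_of_cofinal_of_noOverheating (h₁ : RungBlowupCofinal)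
    (h₂ : NoOverheating) :
    ∃ (C₀ cmin cmax δ : ℝ) (L : ℕ → ℕ) (ε c : ℕ → ℝ)
      (R : ℕ → (EuclideanSpace ℝ (Fin 3) ≃ₗᵢ[ℝ] EuclideanSpace ℝ (Fin 3)))
      (u : ℕ → ℝ → EuclideanSpace ℝ (Fin 3) → EuclideanSpace ℝ (Fin 3))
      (p : ℕ → ℝ → EuclideanSpace ℝ (Fin 3) → ℝ)
      (d : ℕ → ℝ → EuclideanSpace ℝ (Fin 3) → EuclideanSpace ℝ (Fin 3)),
      1 < cmin ∧ 0 < δ ∧ Tendsto ε atTop (𝓝 0) ∧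
        ∀ n, AngularLadder.IsWindowProfile (L n) C₀ cmin cmax δ (ε n) (c n) (R n) (u n) (p n)
          (d n) := by
  obtain ⟨C₀, cmin, cmax, δ, L₀, ε, hcmin, hδ, hε, hwin⟩ := h₂
  choose L hLge hLsing using fun n : ℕ => h₁ (max L₀ n)
  choose c R u p d hW using fun n : ℕ =>
    hwin (L n) (le_trans (le_max_left _ _) (hLge n)) (hLsing n)
  have hε' : Tendsto (fun n : ℕ => ε (L n)) atTop (𝓝 0) :=
    hε.comp (tendsto_atTop_mono (fun n => le_trans (le_max_right _ _) (hLge n)) tendsto_id)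
  exact ⟨C₀, cmin, cmax, δ, L, fun n => ε (L n), c, R, u, p, d, hcmin, hδ, hε', hW⟩

/-- **The ladder disproves the wall on its way to Clay (C).** `K1 ∧ K2 ∧ K3` refutes the Type-I
rotated-DSS Liouville conjecture: route `AngularGalerkinLadder` is a mechanism for crux #5 of route
`Blowup`, and cannot close in any world where Open Problem 5.1 has a positive answer.
[cite: BradshawTsai2017CPDE, §5 Open Problem 5.1] -/
theorem not_typeIDSSLiouvilleConjecture_of_ladder (h₁ : RungBlowupCofinal) (h₂ : NoOverheating)
    (h₃ : LimitTransfer) : ¬ TypeIDSSLiouvilleConjecture := by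
  obtain ⟨C₀, cmin, cmax, δ, L, ε, c, R, u, p, d, hcmin, hδ, hε, hwin⟩ :=
    exists_windowSequence_of_cofinal_of_noOverheating h₁ h₂
  exact exists_rdssProfile_iff_not_typeIDSSLiouvilleConjecture.1
    (h₃ C₀ cmin cmax δ L ε c R u p d hcmin hδ hε hwin)

/-- Contrapositive for the census: in a world where the Type-I rotated-DSS Liouville conjecture holds,
the three cruxes cannot hold together — at least one of K1, K2, K3 is false (which one is not decided
here). [cite: BradshawTsai2017CPDE, §5 Open Problem 5.1] -/
theorem not_ladder_of_typeIDSSLiouvilleConjecture (hW : TypeIDSSLiouvilleConjecture) :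
    ¬ (RungBlowupCofinal ∧ NoOverheating ∧ LimitTransfer) :=
  fun h => not_typeIDSSLiouvilleConjecture_of_ladder h.1 h.2.1 h.2.2 hW

end Summit.NavierStokesRegularity.AngularGalerkinLadderWallPrice
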